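import Summits.BirchSwinnertonDyer.BirchSwinnertonDyer.Theorems.QuadraticBranchSignedControlPlusEtaNonsurjPrimeLFunction
import Summits.BirchSwinnertonDyer.BirchSwinnertonDyer.Theorems.QuadraticBranchSignedControlPlusEtaNonsurjCongruentAnchor
import HarnessLib

/-!
# Route `QuadraticBranchSignedControl` (rung K8, cell `bsd-potss`), residual crux
# `PlusEtaMainConjectureNonsurj` (stmt-BirchSwinnertonDyer-19606): the PRIME-`L`-FUNCTION ROAD on the
# crux's ROWS — the rank-`0` TAMAGAWA rows sharpened to `Char(X⁺(V/K_∞)^η) ∈ {(p), (L_p⁺(V,η,X))}`, and the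
# rank-`1` rows with a CONGRUENT UNIT ANCHOR settled per row modulo Hatley–Lei 2019 Thm. 4.6
# (seat `bsd-potss-k8eta-c2` g4; file 2 of 2, sequel of `…PlusEtaNonsurjPrimeLFunction.lean`)

WHAT. File 1 (`EtaPrimeRoad`, p508939) proved: on a row with `Sel_{p^∞}(W/ℚ)` infinite and `L_p⁺(V,η,X)`
PRIME in `Λ`, (C1⁺_η)(V,p) ⟸ `μ(X⁺(V/K_∞)^η) = 0` (+ Thm. 2.2η, Thm. 4.1η rational clause), by three lines of
UFD algebra. This file reads it on the census rows of crux 19606 (seat g3, `N_W < 5·10⁵`, all `p = 5` off CM):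

* §1 `prime_of_valuation_constantCoeff_eq_one`: `v_p(f(0)) = 1 ⟹ f` prime in `Λ` (one constant term of a
  factorisation is a unit).
* §2 the 7 rank-`0` TAMAGAWA rows (`ord_p(#Sel_{p^∞}(W/ℚ)·Tam(W)) = 1`): with the value identity
  `v_p(L_p⁺(V,η,0)) = v_p(L(W,1)/Ω_W)` (tree) and the DISPLAYED analytic input `v_p(L(W,1)/Ω_W) = 1` (Cremona:
  `#Ш_an = 1`, `5 ∥ Tam`, `#W(ℚ)_tors = 1` on 78300bh1, 159300l1, 404325f1, 164700i1/n1, 417600fp1;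
  `#Ш_an = 4` on 162675n1), `L_p⁺(V,η,X)` is PRIME, so seat g3's dichotomy «`μ = 0` ∨ `Char = (p)`»
  (`EtaTamagawaDichotomy.eta_hasUnitContent_or_charIdeal_eq_span_C`) + exactness (`eta_valuation_charGenerator_eq_one`,
  `g ∉ Λˣ`) become **`Char(X⁺(V/K_∞)^η) = (p)` OR `Char(X⁺(V/K_∞)^η) = (L_p⁺(V,η,X))`** — the second branch IS
  (C1⁺_η) at the datum; and (C1⁺_η)(V,p) ⟸ `μ = 0` WITHOUT ctrl g4's converse road / L₀ / GZK
  (`quadraticBranchPlusEtaMainConjectureAt_of_hasUnitContent_tamagawaRow`).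
* §3 the rank-`≥ 1` rows with a congruent anchor: Hatley–Lei Thm. 4.6 at `η` (DISPLAYED as `hHL`, seat g3's
  `EtaCongruentAnchor.etaMu_of_modPCongruent{,_unitRow}`) transfers `μ = 0` from an anchor `V′` with
  `V′[p] ≅ V[p]`; with `(L_p⁺(V,η,X)) = (X)` and `Sel_{p^∞}(W/ℚ)` infinite, file 1 gives (C1⁺_η)(V,p). On the
  census: the 9 non-CM rank-`1` rows 104400dc1, 26100h1, 243900o1, 243900p1, 313200el1, 341775ca1, 341775dj1,
  417600ke1, 458100j1 (all `p = 5`, image `C_ns⁺(5)`, plus-`η` `(λ,μ)_an = (1,0)`, PARI) have CM UNIT anchors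
  (3600bb1, 900b1, 10800cj1, 11025e1, 14400cz1; Kraus–Oesterlé Prop. 4 certificates j270714) — so there
  (C1⁺_η)(V,5) holds MODULO the printed Hatley–Lei transfer + the certified congruence + the PARI shape; the
  other 7 non-CM and the 240 CM rank-`1` rows with `λ_an = 1` reduce to `μ = 0` for CM `η`-objects
  (Pollack–Rubin's remark p. 448), exactly as the 7 Tamagawa rows do (seat g3).

HONEST FRAMING (cell `bsd-potss`, run/shared/lean/pub/bsd-potss/; FULL-BSD rank ≤ 1 programme,
tranche 1b, HUMAN RULING D-0036/D-0074): BOOKKEEPING THEOREMS ONLY — no definition, no named Literature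
fact minted, no Summits-side `def … : Prop`, no `sorry`, axioms standard. CONDITIONAL on DISPLAYED binders
(`μ = 0` at the anchor / at `V`; the Hatley–Lei transfer `hHL`; `ModPCongruent V′ V p`; the SHAPE of
`L_p⁺(V,η,X)` and `v_p(L(W,1)/Ω_W)` — analytic inputs) and on named facts (Kobayashi Thm. 2.2 / 4.1 at `η`,
Kitajima–Otsuki 1.3 at `η`, Poitou–Tate, modularity, GZK — hypothesis position). No stub of 19606 is proved by
name; the crux stays OPEN; nothing is booked; no label / mark / count moves; `BSD(W,p)` is claimed for no
pair. `--supports stmt-BirchSwinnertonDyer-19606`.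

References: [Kobayashi2003] Thm. 2.2 (p. 5), §4 + Thm. 4.1 first display (p. 8), (3.6) (p. 7), Thm. 9.3 with
(9.33); [GreenbergLNM1716] §4 Lemma 4.2 (p. 102); [GreenbergVatsal2000] p. 2 (2); [HatleyLei2019] Thm. 4.6;
[KrausOesterle1992] Prop. 4; [KitajimaOtsuki2018] Main Thm. 1.3; [PollackRubin2004] remark p. 448;
[Washington1997] §7.1, §13.1; [MazurTateTeitelbaum1986Invent] §I.8 (8.6).
-/

set_option autoImplicit false
set_option linter.dupNamespace false

noncomputable section

open scoped Classical

open CongruenceSubgroup Field Function NumberField IsDedekindDomain WeierstrassCurve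
open Literature.NumberTheory.EllipticCurves
open Literature.NumberTheory.EllipticCurves.ModularForms
open Literature.NumberTheory.EllipticCurves.Rank1Residual
open Literature.NumberTheory.EllipticCurves.Rank1Residual.Typed
open Literature.NumberTheory.GaloisRepresentations
open Literature.NumberTheory.GaloisCohomology
open Literature.NumberTheory.EllipticCurves.IwasawaAlgebra
open Literature.NumberTheory.EllipticCurves.IwasawaDual ZpExtension
open Literature.NumberTheory.EllipticCurves.GreenbergVatsal2000
open Summit.BirchSwinnertonDyer.Rank1Residual.X11b.Levels
open Summit.BirchSwinnertonDyer.Rank1Residual.X11b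
open Summit.BirchSwinnertonDyer.Rank1Residual.Additive
open Summit.BirchSwinnertonDyer.Rank1Residual.Additive.SignedTwist
open scoped ContRepresentation
open Summit.BirchSwinnertonDyer.Rank1Residual.AdditivePotMult
open Summit.BirchSwinnertonDyer.Rank1Residual.O6 (ModPCongruent)

namespace Summit.BirchSwinnertonDyer.BirchSwinnertonDyer.Theorems

namespace EtaPrimeRoad

/-! ## §1 `Λ`-algebra: `v_p(f(0)) = 1 ⟹ f` prime -/

section Algebra

variable {p : ℕ} [hp : Fact p.Prime]

/-- A non-zero `p`-adic integer of valuation `0` is a unit. [folklore] -/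
theorem isUnit_of_valuation_eq_zero {x : ℤ_[p]} (hx : x ≠ 0) (hv : x.valuation = 0) : IsUnit x := by
  rw [PadicInt.isUnit_iff, PadicInt.norm_eq_zpow_neg_valuation hx, hv]
  simp

/-- **`v_p(f(0)) = 1 ⟹ f` is a PRIME element of `Λ = ℤ_p⟦T⟧`.** If `f = a·b` then
`v_p(a(0)) + v_p(b(0)) = 1`, so one constant term is a `p`-adic unit, so that factor is a unit of `Λ`
(a power series is a unit iff its constant term is); `f ∉ Λˣ`; and `Λ` is a UFD (Mathlib: power series
over a PID), so irreducible = prime. The shape of `L_p⁺(V,η,X)` on the rank-`0` TAMAGAWA rows of crux 19606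
(`v_p(L(W,1)/Ω_W) = 1`, value identity). [cite: Washington1997, §7.1 (units of Λ) and §13.1] -/
theorem prime_of_valuation_constantCoeff_eq_one {f : IwasawaAlgebra p}
    (hv : ((PowerSeries.constantCoeff f : ℤ_[p]) : ℚ_[p]).valuation = 1) : Prime f := by
  have hv' : (PowerSeries.constantCoeff f).valuation = 1 := by
    rw [PadicInt.valuation_coe] at hv
    exact_mod_cast hv
  have hf0 : PowerSeries.constantCoeff f ≠ 0 := by
    intro h
    rw [h, PadicInt.valuation_zero] at hv'
    exact zero_ne_one hv'
  refine UniqueFactorizationMonoid.irreducible_iff_prime.mp (irreducible_iff.mpr ⟨?_, fun a b hab ↦ ?_⟩)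
  · exact EtaTamagawaDichotomy.not_isUnit_of_valuation_constantCoeff_ne_zero
      (by rw [hv]; exact one_ne_zero)
  · have hab0 : PowerSeries.constantCoeff f =
        PowerSeries.constantCoeff a * PowerSeries.constantCoeff b := by
      rw [hab, map_mul]
    have ha0 : PowerSeries.constantCoeff a ≠ 0 := fun h ↦ hf0 (by rw [hab0, h, zero_mul])
    have hb0 : PowerSeries.constantCoeff b ≠ 0 := fun h ↦ hf0 (by rw [hab0, h, mul_zero])
    have hsum : (PowerSeries.constantCoeff a).valuation + (PowerSeries.constantCoeff b).valuation = 1 := by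
      rw [← PadicInt.valuation_mul ha0 hb0, ← hab0, hv']
    rcases Nat.eq_zero_or_pos (PowerSeries.constantCoeff a).valuation with ha | ha
    · exact Or.inl (PowerSeries.isUnit_iff_constantCoeff.mpr (isUnit_of_valuation_eq_zero ha0 ha))
    · have hb : (PowerSeries.constantCoeff b).valuation = 0 := by omega
      exact Or.inr (PowerSeries.isUnit_iff_constantCoeff.mpr (isUnit_of_valuation_eq_zero hb0 hb))

end Algebra

/-! ## §2 The rank-`0` TAMAGAWA rows: `Char(X⁺(V/K_∞)^η) = (p)` OR `= (L_p⁺(V,η,X))` -/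

section TamagawaRows

variable (W : WeierstrassCurve ℚ) [W.IsElliptic] [W.IsGloballyMinimal] (p : ℕ) [hp : Fact p.Prime]

/-- **TAMAGAWA ROWS SHARPENED: `L_p⁺(V,η,X)` is prime and `Char(X⁺(V/K_∞)^η) = (p)` OR
`Char(X⁺(V/K_∞)^η) = (L_p⁺(V,η,X))`.** `W` globally minimal, `p ≥ 5`, `V` a globally minimal model of
`W^{(p*)}` good at `p` with `a_p(V) = 0`; `Sel_{p^∞}(W/ℚ)` finite with `ord_p #Sel_{p^∞}(W/ℚ) + ord_p Tam(W) = 1`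
(a Tamagawa row); DISPLAYED analytic input `hv1`: `v_p(L(W,1)/Ω_W) = 1` (for the rational `L(W,1)/Ω_W`);
named facts `hPT`, `hmod`, `h22`, `h41` (rational clause), `hKO`. On the node's frame (`K₀`, `ηq`, a newform
`f` of `V`, the period ratio `ϖ`, ANY `Lη` with the plus interpolation property at `η`, `κ` cyclotomic,
`γ ∈ Gal(ℚ̄/K₀)` a generator matching the variable) and for EVERY `η`-datum `D`: `Lη` is prime (§1 + the value
identity `valuation_constantCoeff_eq_padicValRat_of_twist`) and `Char(D.X) ∈ {(p), (Lη)}` — seat g3's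
dichotomy `μ = 0 ∨ Char = (p)` with its first branch run through file 1's three lines (`g ∣ pⁿ Lη`, `p ∤ g`,
`g ∉ Λˣ` by `v_p(g(0)) = 1`). So on these rows (C1⁺_η) at a datum ⟺ `Char ≠ (p)` ⟺ `μ = 0`. CONDITIONAL;
nothing booked. [cite: Kobayashi2003, §4 Even main conjecture and Thm. 4.1 (p. 8), (3.6) (p. 7), Thm. 9.3 with (9.33)]
[cite: KitajimaOtsuki2018, Main Thm. 1.3] [cite: GreenbergLNM1716, §4 Lemma 4.2 (p. 102)]
[cite: GreenbergVatsal2000, p. 2 (2)] [cite: MazurTateTeitelbaum1986Invent, §I.8 (8.6)] -/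
theorem eta_prime_and_charIdeal_eq_span_C_or_eq_span_tamagawaRow
    (hPT : poitouTate_selmerStructure_duality_real ℚ) (hmod : hasEntireLFunction_rat)
    (h22 : Kobayashi2003.thm22_etaSignedSelmerDual_finite_torsion)
    (h41 : Kobayashi2003.thm41_plusEtaCharIdeal_dvd)
    (hKO : KitajimaOtsuki2018.mainThm13_etaSignedSelmerDual_noFiniteSubmodule)
    (V : WeierstrassCurve ℚ) [V.IsElliptic] [V.IsGloballyMinimal] (C : VariableChange ℚ)
    (hp5 : 5 ≤ p) (hCV : C • W.quadraticTwist ((-1) ^ (p / 2) * p) = V)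
    (hgood : V.HasGoodReductionAtPrime p) (hap : V.frobeniusTrace p = 0)
    [Finite ↥(W.selmerGroupPInfty p)]
    (heq1 : padicValNat p (Nat.card ↥(W.selmerGroupPInfty p)) + padicValNat p W.tamagawaProduct = 1)
    (hv1 : ∀ q : ℚ, W.entireLFunction 1 / (W.realPeriodRat : ℂ) = (q : ℂ) → padicValRat p q = 1)
    (K₀ : Type) [Field K₀] [NumberField K₀] [IsCyclotomicExtension {p} ℚ K₀]
    [(galRange (K := ℚ) K₀).Normal] (ηq : absoluteGaloisGroup ℚ →* ℤˣ)
    (hηK : ∀ σ ∈ galRange (K := ℚ) K₀, ηq σ = 1) (hη1 : ηq ≠ 1)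
    {N : ℕ} [NeZero N] {f : CuspForm (Gamma0 N) 2} (hf : IsNewformOf V f) (ϖ : ℚ)
    (hϖ : if Even (p / 2) then (ϖ : ℝ) * V.realPeriodRat = plusPeriod f
      else (ϖ : ℝ) * V.imaginaryPeriodRat = minusPeriod f)
    (Lη : IwasawaAlgebra p) (hL : IsQuadraticBranchPlusLFunction f p ϖ Lη)
    {κ : ZpExtension ℚ p} {γ : absoluteGaloisGroup ℚ} (hκ : κ.IsCyclotomic) (hγ : κ.IsTopGenerator γ)
    (hγK : γ ∈ galRange (K := ℚ) K₀) (hγc : IsCyclotomicVariable p γ)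
    (D : EtaSignedSelmerDualData V κ K₀ ℚ_[p] ηq γ 1) :
    Prime Lη ∧ (D.charIdeal = Ideal.span {PowerSeries.C (p : ℤ_[p])} ∨ D.charIdeal = Ideal.span {Lη}) := by
  have hp2 : p ≠ 2 := by omega
  -- `Lη` is prime: `v_p(Lη(0)) = v_p(L(W,1)/Ω_W) = 1`
  obtain ⟨q, hq⟩ := EvenControlZero.exists_rat_entireLFunction_one_div_of_twist W p hmod hp2 V C hCV hgood hf hϖ
  obtain ⟨hval, -⟩ := valuation_constantCoeff_eq_padicValRat_of_twist p hmod hp2 W V C hCV hgood hf hϖ hL hq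
  have hLprime : Prime Lη := prime_of_valuation_constantCoeff_eq_one (by rw [hval, hv1 q hq])
  refine ⟨hLprime, ?_⟩
  haveI : D.charIdeal.IsPrincipal := charIdeal_isPrincipal_holds p D.X
  obtain ⟨g, hg⟩ := Submodule.IsPrincipal.principal D.charIdeal
  have hg' : D.charIdeal = Ideal.span {g} := hg
  rcases EtaTamagawaDichotomy.eta_hasUnitContent_or_charIdeal_eq_span_C W p V C hp5 hCV hgood hap heq1.le K₀
      ηq hηK hη1 hκ hγ hγK D hg' with hu | hC
  · right
    obtain ⟨⟨n, hn⟩, -⟩ := EtaSignedSelmerDualData.thm41_plus_of_facts h22 h41 hηK hη1 hp2 hgood hap hf ϖ hϖ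
      Lη hL hκ hγ hγK hγc D
    obtain ⟨-, hgU, -, -⟩ := EtaTamagawaDichotomy.eta_valuation_charGenerator_eq_one W p hPT hKO V C hp5 hCV
      hgood hap heq1 K₀ ηq hηK hη1 hκ hγ hγK D hg'
    rw [hg', Ideal.mem_span_singleton] at hn
    have hC' : ((p : IwasawaAlgebra p) ^ n : IwasawaAlgebra p) = PowerSeries.C ((p : ℤ_[p]) ^ n) := by
      rw [map_pow, map_natCast]
    rw [hC'] at hn
    rw [hg']
    exact span_eq_span_of_prime_of_hasUnitContent_of_dvd hLprime hu n hn hgU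
  · exact Or.inl hC

/-- **(C1⁺_η)(V,p) on a TAMAGAWA row from `μ(X⁺(V/K_∞)^η) = 0`, WITHOUT the converse road.** Hypotheses as
in `eta_prime_and_charIdeal_eq_span_C_or_eq_span_tamagawaRow` plus `hμ` (`μ = 0` for every `η`-datum,
displayed — verbatim the skeleton's `EtaMuZeroAt V p` = `stub_etaMC_r0_mu` at the pair): `μ = 0` excludes
the branch `Char = (p)`, leaving `Char = (Lη)`. Compared with seat g2's
`EtaMuSaturation.quadraticBranchPlusEtaMainConjectureAt_of_hasUnitContent_of_missingLowerBoundAt` (∘ ctrl g4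
p464359): no GZK, no L₀ `MissingLowerBoundAt W p`; instead the displayed valuation `v_p(L(W,1)/Ω_W) = 1`.
CONDITIONAL; nothing booked. [cite: Kobayashi2003, §4 Even main conjecture and Thm. 4.1 (p. 8)]
[cite: GreenbergVatsal2000, p. 2 (2)] [cite: KitajimaOtsuki2018, Main Thm. 1.3] -/
theorem quadraticBranchPlusEtaMainConjectureAt_of_hasUnitContent_tamagawaRow
    (hPT : poitouTate_selmerStructure_duality_real ℚ) (hmod : hasEntireLFunction_rat)
    (h22 : Kobayashi2003.thm22_etaSignedSelmerDual_finite_torsion)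
    (h41 : Kobayashi2003.thm41_plusEtaCharIdeal_dvd)
    (hKO : KitajimaOtsuki2018.mainThm13_etaSignedSelmerDual_noFiniteSubmodule)
    (V : WeierstrassCurve ℚ) [V.IsElliptic] [V.IsGloballyMinimal] (C : VariableChange ℚ)
    (hp5 : 5 ≤ p) (hCV : C • W.quadraticTwist ((-1) ^ (p / 2) * p) = V)
    (hgood : V.HasGoodReductionAtPrime p) (hap : V.frobeniusTrace p = 0)
    [Finite ↥(W.selmerGroupPInfty p)]
    (heq1 : padicValNat p (Nat.card ↥(W.selmerGroupPInfty p)) + padicValNat p W.tamagawaProduct = 1)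
    (hv1 : ∀ q : ℚ, W.entireLFunction 1 / (W.realPeriodRat : ℂ) = (q : ℂ) → padicValRat p q = 1)
    (hμ : ∀ (K₀ : Type) [Field K₀] [NumberField K₀] [IsCyclotomicExtension {p} ℚ K₀]
        [(galRange (K := ℚ) K₀).Normal] (ηq : absoluteGaloisGroup ℚ →* ℤˣ),
        (∀ σ ∈ galRange (K := ℚ) K₀, ηq σ = 1) → ηq ≠ 1 →
      ∀ (κ : ZpExtension ℚ p) (γ : absoluteGaloisGroup ℚ),
        κ.IsCyclotomic → κ.IsTopGenerator γ → γ ∈ galRange (K := ℚ) K₀ →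
      ∀ (D : EtaSignedSelmerDualData V κ K₀ ℚ_[p] ηq γ 1) (g : IwasawaAlgebra p),
        D.charIdeal = Ideal.span {g} → HasUnitContent g) :
    QuadraticBranchPlusEtaMainConjectureAt V p := by
  intro K₀ _ _ _ _ ηq hηK hη1 N _ f hp2 hgood' hap' hf ϖ hϖ Lη hL κ γ hκ hγ hγK hγc D
  obtain ⟨hfin, htor⟩ :=
    EtaSignedSelmerDualData.finite_isTorsion_of_thm22 h22 hηK hp2 hgood' hap' hκ hγ hγK D
  refine ⟨hfin, htor, ?_⟩
  rcases (eta_prime_and_charIdeal_eq_span_C_or_eq_span_tamagawaRow W p hPT hmod h22 h41 hKO V C hp5 hCV hgood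
      hap heq1 hv1 K₀ ηq hηK hη1 hf ϖ hϖ Lη hL hκ hγ hγK hγc D).2 with hC | hL'
  · exact absurd (hμ K₀ ηq hηK hη1 κ γ hκ hγ hγK D _ hC)
      (EtaTamagawaDichotomy.not_hasUnitContent_of_span_eq_span_C rfl)
  · exact hL'

end TamagawaRows

/-! ## §3 The rank-`≥ 1` rows with a CONGRUENT ANCHOR: (C1⁺_η)(V,p) modulo Hatley–Lei Thm. 4.6 -/

section Anchor

variable (p : ℕ) [hp : Fact p.Prime]

/-- **(C1⁺_η)(V,p) on a rank-`≥ 1` row with `(L_p⁺(V,η,X)) = (X)` FROM A CONGRUENT ANCHOR with `μ = 0`.**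
`W` the `p*`-twist partner of the globally minimal good `a_p = 0` curve `V` (`C • W^{(p*)} = V`, `p ≥ 5`),
`Sel_{p^∞}(W/ℚ)` infinite; an anchor `V′` (globally minimal, good at `p`, `a_p(V′) = 0`, `V′[p] ≅ V[p]`:
`ModPCongruent V′ V p`) with `μ(X⁺(V′/K_∞)^η) = 0` for every `η`-datum (`hμ'`, displayed); the TRANSFER `hHL`
(Hatley–Lei 2019 Thm. 4.6 at `η`, displayed verbatim as in seat g3's `EtaCongruentAnchor.etaMu_of_modPCongruent`);
the SHAPE `(Lη) = (X)` (displayed); named facts `h22`, `h41`. Then (C1⁺_η)(V,p): g3's transfer gives `μ = 0`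
at `V`, file 1's `…_of_span_eq_span_X_of_hasUnitContent` concludes. CONDITIONAL; nothing booked.
[cite: HatleyLei2019, Thm. 4.6] [cite: Kobayashi2003, §4 Even main conjecture and Thm. 4.1 (p. 8)]
[cite: GreenbergVatsal2000, p. 2 (2) and Thm. (1.4)] -/
theorem quadraticBranchPlusEtaMainConjectureAt_of_modPCongruent_of_span_eq_span_X
    (h22 : Kobayashi2003.thm22_etaSignedSelmerDual_finite_torsion)
    (h41 : Kobayashi2003.thm41_plusEtaCharIdeal_dvd)
    (hHL : ∀ (V' : WeierstrassCurve ℚ) [V'.IsElliptic] [V'.IsGloballyMinimal]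
        (V : WeierstrassCurve ℚ) [V.IsElliptic] [V.IsGloballyMinimal],
        5 ≤ p → V'.HasGoodReductionAtPrime p → V'.frobeniusTrace p = 0 →
        V.HasGoodReductionAtPrime p → V.frobeniusTrace p = 0 → ModPCongruent V' V p →
      (∀ (K₀ : Type) [Field K₀] [NumberField K₀] [IsCyclotomicExtension {p} ℚ K₀]
          [(galRange (K := ℚ) K₀).Normal] (ηq : absoluteGaloisGroup ℚ →* ℤˣ),
          (∀ σ ∈ galRange (K := ℚ) K₀, ηq σ = 1) → ηq ≠ 1 →
        ∀ (κ : ZpExtension ℚ p) (γ : absoluteGaloisGroup ℚ),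
          κ.IsCyclotomic → κ.IsTopGenerator γ → γ ∈ galRange (K := ℚ) K₀ →
        ∀ (D : EtaSignedSelmerDualData V' κ K₀ ℚ_[p] ηq γ 1) (g : IwasawaAlgebra p),
          D.charIdeal = Ideal.span {g} → HasUnitContent g) →
      (∀ (K₀ : Type) [Field K₀] [NumberField K₀] [IsCyclotomicExtension {p} ℚ K₀]
          [(galRange (K := ℚ) K₀).Normal] (ηq : absoluteGaloisGroup ℚ →* ℤˣ),
          (∀ σ ∈ galRange (K := ℚ) K₀, ηq σ = 1) → ηq ≠ 1 →
        ∀ (κ : ZpExtension ℚ p) (γ : absoluteGaloisGroup ℚ),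
          κ.IsCyclotomic → κ.IsTopGenerator γ → γ ∈ galRange (K := ℚ) K₀ →
        ∀ (D : EtaSignedSelmerDualData V κ K₀ ℚ_[p] ηq γ 1) (g : IwasawaAlgebra p),
          D.charIdeal = Ideal.span {g} → HasUnitContent g))
    (V' : WeierstrassCurve ℚ) [V'.IsElliptic] [V'.IsGloballyMinimal]
    (V : WeierstrassCurve ℚ) [V.IsElliptic] [V.IsGloballyMinimal]
    (W : WeierstrassCurve ℚ) [W.IsElliptic] (C : VariableChange ℚ)
    (hp5 : 5 ≤ p) (hgood' : V'.HasGoodReductionAtPrime p) (hap' : V'.frobeniusTrace p = 0)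
    (hμ' : ∀ (K₀ : Type) [Field K₀] [NumberField K₀] [IsCyclotomicExtension {p} ℚ K₀]
        [(galRange (K := ℚ) K₀).Normal] (ηq : absoluteGaloisGroup ℚ →* ℤˣ),
        (∀ σ ∈ galRange (K := ℚ) K₀, ηq σ = 1) → ηq ≠ 1 →
      ∀ (κ : ZpExtension ℚ p) (γ : absoluteGaloisGroup ℚ),
        κ.IsCyclotomic → κ.IsTopGenerator γ → γ ∈ galRange (K := ℚ) K₀ →
      ∀ (D : EtaSignedSelmerDualData V' κ K₀ ℚ_[p] ηq γ 1) (g : IwasawaAlgebra p),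
        D.charIdeal = Ideal.span {g} → HasUnitContent g)
    (hCV : C • W.quadraticTwist ((-1) ^ (p / 2) * p) = V)
    (hgood : V.HasGoodReductionAtPrime p) (hap : V.frobeniusTrace p = 0) (hcong : ModPCongruent V' V p)
    (hinf : ¬ Finite ↥(W.selmerGroupPInfty p))
    (hX : ∀ {N : ℕ} [NeZero N] {f : CuspForm (Gamma0 N) 2}, IsNewformOf V f →
      ∀ (ϖ : ℚ), (if Even (p / 2) then (ϖ : ℝ) * V.realPeriodRat = plusPeriod f
          else (ϖ : ℝ) * V.imaginaryPeriodRat = minusPeriod f) →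
      ∀ (Lη : IwasawaAlgebra p), IsQuadraticBranchPlusLFunction f p ϖ Lη →
        Ideal.span {Lη} = Ideal.span {(PowerSeries.X : IwasawaAlgebra p)}) :
    QuadraticBranchPlusEtaMainConjectureAt V p :=
  quadraticBranchPlusEtaMainConjectureAt_of_span_eq_span_X_of_hasUnitContent W p h22 h41 V C hp5 hCV hgood hap
    hinf hX (EtaCongruentAnchor.etaMu_of_modPCongruent p hHL V' V hp5 hgood' hap' hgood hap hcong hμ')

/-- **(C1⁺_η)(V,p) on an analytic-rank-`1` row with `(L_p⁺(V,η,X)) = (X)` FROM A CONGRUENT UNIT-ROW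
ANCHOR** — the shape of the 9 unit-anchored non-CM rank-`1` rows of crux 19606 below `5·10⁵`. The anchor
`V′` is a globally minimal model of `W′^{(p*)}`, good at `p` with `a_p(V′) = 0`, with `Sel_{p^∞}(W′/ℚ) = 0`
and `p ∤ Tam(W′)` (a UNIT row: `μ(X⁺(V′/K_∞)^η) = 0` is seat g2's THEOREM
`EtaMuBound.eta_hasUnitContent_of_selmer_trivial_of_not_dvd_tamagawa`, through g3's
`EtaCongruentAnchor.etaMu_of_modPCongruent_unitRow`); `V′[p] ≅ V[p]`; `r_an(W) = 1` (so `Sel_{p^∞}(W/ℚ)` is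
infinite by GZK); the transfer `hHL` and the shape `(Lη) = (X)` displayed; named facts `h22`, `h41`, `hGZK`.
Per row the remaining inputs are: Hatley–Lei Thm. 4.6 (print), a Kraus–Oesterlé certificate of
`ModPCongruent V′ V 5` (kit j270714), PARI's `(λ,μ) = (1,0)` for `L_5⁺(V,η,X)`, and Cremona's
`r_an(W) = 1`, `Sel_{5^∞}(W′/ℚ) = 0`, `5 ∤ Tam(W′)`. CONDITIONAL; nothing booked.
[cite: HatleyLei2019, Thm. 4.6] [cite: Kobayashi2003, §4 Even main conjecture and Thm. 4.1 (p. 8)]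
[cite: KrausOesterle1992, Prop. 4] [cite: GreenbergLNM1716, §3 Prop. 3.8, §4 Lemma 4.2] -/
theorem quadraticBranchPlusEtaMainConjectureAt_of_modPCongruent_unitRow_of_span_eq_span_X
    (h22 : Kobayashi2003.thm22_etaSignedSelmerDual_finite_torsion)
    (h41 : Kobayashi2003.thm41_plusEtaCharIdeal_dvd)
    (hGZK : rank_eq_analyticRank_of_analyticRank_le_one)
    (hHL : ∀ (V' : WeierstrassCurve ℚ) [V'.IsElliptic] [V'.IsGloballyMinimal]
        (V : WeierstrassCurve ℚ) [V.IsElliptic] [V.IsGloballyMinimal],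
        5 ≤ p → V'.HasGoodReductionAtPrime p → V'.frobeniusTrace p = 0 →
        V.HasGoodReductionAtPrime p → V.frobeniusTrace p = 0 → ModPCongruent V' V p →
      (∀ (K₀ : Type) [Field K₀] [NumberField K₀] [IsCyclotomicExtension {p} ℚ K₀]
          [(galRange (K := ℚ) K₀).Normal] (ηq : absoluteGaloisGroup ℚ →* ℤˣ),
          (∀ σ ∈ galRange (K := ℚ) K₀, ηq σ = 1) → ηq ≠ 1 →
        ∀ (κ : ZpExtension ℚ p) (γ : absoluteGaloisGroup ℚ),
          κ.IsCyclotomic → κ.IsTopGenerator γ → γ ∈ galRange (K := ℚ) K₀ →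
        ∀ (D : EtaSignedSelmerDualData V' κ K₀ ℚ_[p] ηq γ 1) (g : IwasawaAlgebra p),
          D.charIdeal = Ideal.span {g} → HasUnitContent g) →
      (∀ (K₀ : Type) [Field K₀] [NumberField K₀] [IsCyclotomicExtension {p} ℚ K₀]
          [(galRange (K := ℚ) K₀).Normal] (ηq : absoluteGaloisGroup ℚ →* ℤˣ),
          (∀ σ ∈ galRange (K := ℚ) K₀, ηq σ = 1) → ηq ≠ 1 →
        ∀ (κ : ZpExtension ℚ p) (γ : absoluteGaloisGroup ℚ),
          κ.IsCyclotomic → κ.IsTopGenerator γ → γ ∈ galRange (K := ℚ) K₀ →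
        ∀ (D : EtaSignedSelmerDualData V κ K₀ ℚ_[p] ηq γ 1) (g : IwasawaAlgebra p),
          D.charIdeal = Ideal.span {g} → HasUnitContent g))
    (V' : WeierstrassCurve ℚ) [V'.IsElliptic] [V'.IsGloballyMinimal]
    (W' : WeierstrassCurve ℚ) [W'.IsElliptic] [W'.IsGloballyMinimal] (C' : VariableChange ℚ)
    (V : WeierstrassCurve ℚ) [V.IsElliptic] [V.IsGloballyMinimal]
    (W : WeierstrassCurve ℚ) [W.IsElliptic] (C : VariableChange ℚ)
    (hp5 : 5 ≤ p) (hCV' : C' • W'.quadraticTwist ((-1) ^ (p / 2) * p) = V')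
    (hgood' : V'.HasGoodReductionAtPrime p) (hap' : V'.frobeniusTrace p = 0)
    (hSel' : W'.selmerGroupPInfty p = ⊥) (hTam' : ¬ p ∣ W'.tamagawaProduct)
    (hCV : C • W.quadraticTwist ((-1) ^ (p / 2) * p) = V)
    (hgood : V.HasGoodReductionAtPrime p) (hap : V.frobeniusTrace p = 0) (hcong : ModPCongruent V' V p)
    (h1 : W.analyticRank = 1)
    (hX : ∀ {N : ℕ} [NeZero N] {f : CuspForm (Gamma0 N) 2}, IsNewformOf V f →
      ∀ (ϖ : ℚ), (if Even (p / 2) then (ϖ : ℝ) * V.realPeriodRat = plusPeriod f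
          else (ϖ : ℝ) * V.imaginaryPeriodRat = minusPeriod f) →
      ∀ (Lη : IwasawaAlgebra p), IsQuadraticBranchPlusLFunction f p ϖ Lη →
        Ideal.span {Lη} = Ideal.span {(PowerSeries.X : IwasawaAlgebra p)}) :
    QuadraticBranchPlusEtaMainConjectureAt V p :=
  quadraticBranchPlusEtaMainConjectureAt_of_span_eq_span_X_of_hasUnitContent W p h22 h41 V C hp5 hCV hgood hap
    (not_finite_selmer_of_analyticRank_eq_one W (p := p) hGZK h1) hX
    (EtaCongruentAnchor.etaMu_of_modPCongruent_unitRow p hHL V' W' C' V hp5 hCV' hgood' hap' hSel' hTam'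
      hgood hap hcong)

end Anchor

end EtaPrimeRoad

end Summit.BirchSwinnertonDyer.BirchSwinnertonDyer.Theorems

end
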